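import Summits.Ventures.CertifiedArithmetic.LowPrec.DoubleRoundingThresholdWitness

/-!
# Double rounding of sums, clause (W) for every pair of format records — no bias hypothesis

HONEST FRAMING (venture CertifiedArithmetic / cell `pub-lowprec`): certified error envelopes and
provably optimal rounding/accumulation schemes for low-precision formats under stated cost models;
every table by two implementations; no hardware or vendor claims.

THEOREM D-dr decides when forming a sum of two data of a narrow format `X` in a wider format `Y`
and rounding back is correctly rounded, `DRAdd X Y := ∀ a b, fl_X(fl_Y(a + b)) = fl_X(a + b)`
(saturating round-to-nearest-even twice). Its clause (W) — `P_Y ≥ 2 P_X + 1` is innocuous, the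
binary case of [Figueroa1995, §2] / [Rump2016, Lemma 4.4] (unbounded exponents), and with gradual
underflow [Roux2014, Theorem 20 and Table II: Coq/Flocq `double_round_plus_FLT`, hypotheses
`p₂ ≥ 2p₁ + 1` and `emin₂ ≤ emin₁`, no overflow] — was available in this tree only as the lean
seat's `MiniFloat.toRat_roundNE_roundNE_add`, which asks for `bias_X ≤ bias_Y` in addition to the
value-set inclusion `F_X ⊆ F_Y`; the named cell binary8p3 → binary16 (exponent bias
`16 > 15`) needed a phantom wider-bias record (`DoubleRoundingDecision.lean` §3), and the general
decision `drAdd_iff_test_of_embedsTest` (`DoubleRoundingThresholdWitness.lean`) carried the bias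
hypothesis.

THIS FILE removes it: `drAdd_of_wide_of_qexp_le` proves clause (W) from `2·m_X + 2 ≤ m_Y`,
`qexp Y ≤ qexp X` and `maxRat X ≤ maxRat Y` alone, i.e. from precision and the embedding
`F_X ⊆ F_Y` (`drAdd_of_wide_of_embedsTest`) — exactly Roux's FLT hypotheses (`qexp` is Flocq's
`emin`) plus the range clause that SATURATION requires, and `drAdd_iff_test` states THEOREM
D-dr for EVERY embedded pair of records with `P_X ≥ 2` as one Boolean test:
`DRAdd X Y ↔ drAddTest X Y` — clause (S) `P_Y = P_X`, clause (T) the saturation threshold on the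
strip `P_X < P_Y ≤ 2 P_X` (`drAdd_iff_lt_threshold`), clause (W) above it. The named payoff is
`Binary8p3_add_via_Binary16_direct` (no phantom record).

WHERE THE BIAS HYPOTHESIS WENT. The Figueroa argument brackets a sum `s ∉ F_Y` between
consecutive `X`-values `v < s < v + G` and needs two facts about `Y`: (i) the midpoint `v + G/2`
is a `Y`-value, (ii) `|s - fl_Y(s)| < G / 2^(m_Y - m_X)`. The old proof took both from
`quantum_X = 2^((m_Y - m_X) + (bias_Y - bias_X)) · quantum_Y`. Here: (i) a sum of two `X`-data is
a whole number of `X`-quanta, so it cannot fall strictly inside a gap of width one quantum — the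
bracketing value has `expCode ≥ 2`, `G ≥ 2` quanta, and the midpoint is a multiple of `G/2` of at
most `P_X + 1` bits within range, a `Y`-value by the embedding clauses alone
(`exists_toRat_eq_midpoint_of_qexp_le`); (ii) a sum that is not a `Y`-value exceeds `2^(P_Y)`
quanta of `X ≥` quanta of `Y`, so it lies in the normal range of `Y` where the relative bound
`u_Y · s` holds, and `u_Y · s < u_Y · 2^(P_X) G = G / 2^(m_Y - m_X)`. Everything else is the lean
seat's proof, reused lemma by lemma (`roundDown_bracket`, `add_eq_midpoint_of_close`,
`forall_lt_of_mem_low/high`).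

TWO IMPLEMENTATIONS: A = `code/enum/doubleround_decision.py` (clause (W) cells of the named
matrix by the parameter test, brute force over the FP6/FP4 sources); B = this file. PLACEMENT:
clause (W) is KNOWN — [Figueroa1995, §2; Rump2016, Lemma 4.4] for unbounded exponents and
[Roux2014, Table II] with gradual underflow under `emin₂ ≤ emin₁` (Coq, no overflow); what this
file adds is only the SATURATING statement over this cell's finite format records (largest finite
value, no infinities) with the hypotheses of the embedding test, kernel-checked in Lean, and the
resulting one-test decision `drAdd_iff_test`. No hardware or vendor claims.
-/

namespace Summit.Ventures.CertifiedArithmetic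

open Literature.ComputerArithmetic.FloatingPoint
open Literature.ComputerArithmetic.FloatingPoint.Format
open Literature.ComputerArithmetic.FloatingPoint.MiniFloat

/-! ## §1 The two bridges without the bias hypothesis -/

/-- Quanta compare like their exponents: `qexp ψ ≤ qexp φ → quantum ψ ≤ quantum φ`. [folklore] -/
theorem quantum_le_quantum_of_qexp_le {φ ψ : Format} (hq : ψ.qexp ≤ φ.qexp) :
    ψ.quantum ≤ φ.quantum := by
  unfold Format.quantum
  exact zpow_le_zpow_right₀ (by norm_num) hq

/-- A WHOLE NUMBER OF QUANTA NEVER FALLS INSIDE A UNIT GAP: if `T · quantum` lies strictly between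
a value `v` and `v + ulp(v)`, then `ulp(v) ≥ 2` quanta, i.e. `expCode v ≥ 2`. [folklore] -/
theorem two_le_expCode_of_mem_gap {φ : Format} {v : MiniFloat φ} {T : ℤ}
    (h1 : v.toRat < (T : ℚ) * φ.quantum)
    (h2 : (T : ℚ) * φ.quantum < v.toRat + 2 ^ (v.expCode - 1) * φ.quantum) : 2 ≤ v.expCode := by
  by_contra hlt
  have he : v.expCode - 1 = 0 := by omega
  rw [he, pow_zero, one_mul] at h2
  rw [toRat_eq_toInt_mul] at h1 h2
  have hq := φ.quantum_pos
  have h1' : (v.toInt : ℚ) < T := lt_of_mul_lt_mul_right h1 hq.le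
  have h2' : (T : ℚ) < v.toInt + 1 := by
    have : (T : ℚ) * φ.quantum < ((v.toInt : ℚ) + 1) * φ.quantum := by linarith
    exact lt_of_mul_lt_mul_right this hq.le
  have a : v.toInt < T := by exact_mod_cast h1'
  have b : T < v.toInt + 1 := by exact_mod_cast h2'
  omega

/-- THE MIDPOINT IS A WIDE VALUE, without the bias hypothesis: for a value `v ≥ 0` of `φ` with
`expCode v ≥ 2` whose successor `v + ulp(v)` is a value, the midpoint `v + ulp(v)/2` is a value of
any `ψ` with `m_φ + 1 ≤ m_ψ`, `qexp ψ ≤ qexp φ`, `maxRat φ ≤ maxRat ψ` (it is a multiple of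
`ulp(v)/2 ≥ 1` quanta with at most `m_φ + 2` significant bits, within range). [folklore] -/
theorem exists_toRat_eq_midpoint_of_qexp_le {φ ψ : Format} (hm : φ.manBits + 1 ≤ ψ.manBits)
    (hq : ψ.qexp ≤ φ.qexp) (hmax : φ.maxRat ≤ ψ.maxRat) {v u : MiniFloat φ} (hv : 0 ≤ v.toRat)
    (he : 2 ≤ v.expCode) (hu : u.toRat = v.toRat + 2 ^ (v.expCode - 1) * φ.quantum) :
    ∃ z : MiniFloat ψ, z.toRat = v.toRat + 2 ^ (v.expCode - 1) * φ.quantum / 2 := by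
  have hqφ := φ.quantum_pos
  obtain ⟨e, he'⟩ : ∃ e, v.expCode - 1 = e + 1 := ⟨v.expCode - 2, by omega⟩
  have hV := toInt_eq_scaledMag_of_nonneg hv
  have hdv : 2 ^ (e + 1) ∣ v.scaledMag := by rw [← he']; exact pow_ulpExp_dvd_scaledMag v
  set N : ℕ := v.scaledMag + 2 ^ e with hN
  have hval : (N : ℚ) * φ.quantum = v.toRat + 2 ^ (v.expCode - 1) * φ.quantum / 2 := by
    rw [toRat_eq_toInt_mul, hV, he', hN, pow_succ]; push_cast; ring
  have hdN : 2 ^ e ∣ N := dvd_add (dvd_trans (pow_dvd_pow 2 (Nat.le_succ e)) hdv) dvd_rfl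
  have hsize : N ≤ 2 ^ (ψ.manBits + 1 + e) := by
    have h1 := scaledMag_add_ulp_le v
    rw [he'] at h1
    calc N ≤ v.scaledMag + 2 ^ (e + 1) :=
          Nat.add_le_add_left (Nat.pow_le_pow_right (by norm_num) (Nat.le_succ e)) _
      _ ≤ 2 ^ (φ.manBits + 1 + (e + 1)) := h1
      _ ≤ 2 ^ (ψ.manBits + 1 + e) := Nat.pow_le_pow_right (by norm_num) (by omega)
  have hmaxN : N ≤ φ.maxScaled := by
    have hG : (0:ℚ) ≤ 2 ^ (v.expCode - 1) * φ.quantum := by positivity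
    have h1 : (N : ℚ) * φ.quantum ≤ (φ.maxScaled : ℚ) * φ.quantum := by
      rw [hval]
      calc v.toRat + 2 ^ (v.expCode - 1) * φ.quantum / 2 ≤ u.toRat := by rw [hu]; linarith
        _ ≤ φ.maxRat := le_trans (le_abs_self _) (abs_toRat_le_maxRat u)
        _ = (φ.maxScaled : ℚ) * φ.quantum := rfl
    exact_mod_cast le_of_mul_le_mul_right h1 hqφ
  obtain ⟨z, hz⟩ :=
    exists_toRat_eq_natMul_of_dvd hq ((maxRat_le_maxRat_iff hq).1 hmax) hdN hsize hmaxN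
  exact ⟨z, hz.trans hval⟩

/-! ## §2 Figueroa's theorem over the embedding hypotheses -/

/-- DOUBLE ROUNDING OF SUMS, positive case, WITHOUT the bias hypothesis: `2·m_φ + 2 ≤ m_ψ`,
`qexp ψ ≤ qexp φ`, `maxRat φ ≤ maxRat ψ`, `0 < a + b` ⇒ `fl_φ(fl_ψ(a + b)) = fl_φ(a + b)`.
[cite: Figueroa1995, §2; Roux2014, Thm 20 and Table II] -/
theorem toRat_roundNE_roundNE_add_of_pos_of_qexp_le {φ ψ : Format}
    (hm : 2 * φ.manBits + 2 ≤ ψ.manBits) (hq : ψ.qexp ≤ φ.qexp) (hmax : φ.maxRat ≤ ψ.maxRat)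
    (a b : MiniFloat φ) (hs : 0 < a.toRat + b.toRat) :
    (roundNE φ (roundNE ψ (a.toRat + b.toRat)).toRat).toRat
      = (roundNE φ (a.toRat + b.toRat)).toRat := by
  set s := a.toRat + b.toRat with hs_def
  have hqφ := φ.quantum_pos
  have hqψ := ψ.quantum_pos
  have hmle : φ.manBits ≤ ψ.manBits := by omega
  have hM := (maxRat_le_maxRat_iff hq).1 hmax
  by_cases hex : ∃ z : MiniFloat ψ, z.toRat = s
  · exact toRat_roundNE_roundNE_of_exists hex
  by_cases hbig : φ.maxRat ≤ s
  · -- both roundings into `φ` saturate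
    have htop : ∃ z : MiniFloat ψ, z.toRat = φ.maxRat := by
      obtain ⟨z, hz⟩ := exists_toRat_eq_of_le hmle hq hmax (top φ)
      exact ⟨z, by rw [hz, toRat_top]⟩
    exact toRat_roundNE_roundNE_of_maxRat_le htop hbig
  have hbig' : s < φ.maxRat := not_le.mp hbig
  have hnsφ : ¬ ∃ y : MiniFloat φ, y.toRat = s := by
    rintro ⟨y, hy⟩
    obtain ⟨z, hz⟩ := exists_toRat_eq_of_le hmle hq hmax y
    exact hex ⟨z, hz.trans hy⟩
  obtain ⟨hv0, hvs, hsu, ⟨u, hu⟩, hgap⟩ := roundDown_bracket hs hbig' hnsφ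
  set v := roundDown φ s with hv_def
  set G := 2 ^ (v.expCode - 1) * φ.quantum with hG_def
  have hG : 0 < G := by positivity
  -- the sum is a whole number `n` of `φ`-quanta
  set T : ℤ := a.toInt + b.toInt with hT_def
  have hsT : s = (T : ℚ) * φ.quantum := by rw [hs_def, toRat_add_toRat]
  have hT0 : 0 < T := by
    have h : (0 : ℚ) * φ.quantum < (T : ℚ) * φ.quantum := by rw [zero_mul, ← hsT]; exact hs
    exact_mod_cast lt_of_mul_lt_mul_right h hqφ.le
  obtain ⟨n, hn⟩ : ∃ n : ℕ, T = n := ⟨T.toNat, (Int.toNat_of_nonneg hT0.le).symm⟩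
  have hsn : s = (n : ℚ) * φ.quantum := by rw [hsT, hn]; push_cast; rfl
  have hnmax : n ≤ φ.maxScaled := by
    have : (n : ℚ) * φ.quantum ≤ (φ.maxScaled : ℚ) * φ.quantum := by rw [← hsn]; exact hbig'.le
    exact_mod_cast le_of_mul_le_mul_right this hqφ
  -- hence the bracket is at least two quanta wide and its midpoint is a `ψ`-value
  have he2 : 2 ≤ v.expCode :=
    two_le_expCode_of_mem_gap (T := T) (by rw [← hsT]; exact hvs) (by rw [← hsT]; exact hsu)
  have hvψ : ∃ z : MiniFloat ψ, z.toRat = v.toRat := exists_toRat_eq_of_le hmle hq hmax v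
  have huψ : ∃ z : MiniFloat ψ, z.toRat = v.toRat + G := by
    obtain ⟨z, hz⟩ := exists_toRat_eq_of_le hmle hq hmax u
    exact ⟨z, hz.trans hu⟩
  have hMψ : ∃ z : MiniFloat ψ, z.toRat = v.toRat + G / 2 :=
    exists_toRat_eq_midpoint_of_qexp_le (by omega) hq hmax hv0 he2 hu
  have hsM : s ≠ v.toRat + G / 2 := by
    intro h; obtain ⟨z, hz⟩ := hMψ; exact hex ⟨z, hz.trans h.symm⟩
  obtain ⟨j, hj⟩ : ∃ j, ψ.manBits = φ.manBits + j := ⟨ψ.manBits - φ.manBits, by omega⟩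
  have hjge : φ.manBits + 2 ≤ j := by omega
  set w := (roundNE ψ s).toRat with hw_def
  -- `s ∉ F_ψ` puts `s` above `2^(p_ψ)` quanta of `φ`, inside the normal range of `ψ`
  have hnbig : 2 ^ (ψ.manBits + 1) < n := by
    by_contra h
    push Not at h
    obtain ⟨z, hz⟩ := exists_toRat_eq_natMul_of_dvd hq hM (g := 0) (n := n)
      (by rw [pow_zero]; exact one_dvd n) (by simpa using h) hnmax
    exact hex ⟨z, hz.trans hsn.symm⟩
  -- the wide rounding error is below `G / 2^j`, `j = m_ψ - m_φ ≥ m_φ + 2`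
  have hclose : |s - w| < G / 2 ^ j := by
    have hsabs : |s| ≤ ψ.maxRat := by rw [abs_of_pos hs]; linarith
    have hlo : 2 ^ ψ.manBits * ψ.quantum ≤ |s| := by
      rw [abs_of_pos hs, hsn]
      have h1 : ((2 ^ ψ.manBits : ℕ) : ℚ) ≤ n := by
        exact_mod_cast ((Nat.pow_le_pow_right (by norm_num) (Nat.le_succ _)).trans hnbig.le)
      push_cast at h1
      calc (2:ℚ) ^ ψ.manBits * ψ.quantum ≤ 2 ^ ψ.manBits * φ.quantum :=
            mul_le_mul_of_nonneg_left (quantum_le_quantum_of_qexp_le hq) (by positivity)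
        _ ≤ n * φ.quantum := mul_le_mul_of_nonneg_right h1 hqφ.le
    refine lt_of_le_of_lt (abs_sub_roundNE_le_unitRoundoff_mul hlo hsabs) ?_
    rw [abs_of_pos hs, Format.unitRoundoff_eq, hj]
    have h1 : s < 2 ^ (φ.manBits + 1 + (v.expCode - 1)) * φ.quantum :=
      lt_of_lt_of_le hsu (toRat_add_ulp_le hv0)
    calc 1 / 2 ^ (φ.manBits + j + 1) * s
        < 1 / 2 ^ (φ.manBits + j + 1) * (2 ^ (φ.manBits + 1 + (v.expCode - 1)) * φ.quantum) :=
          mul_lt_mul_of_pos_left h1 (by positivity)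
      _ = G / 2 ^ j := by rw [hG_def]; field_simp; ring
  rcases lt_or_gt_of_ne hsM with hlt | hgt
  · -- `s < M`: `w ∈ [v, M]`
    have hwv : v.toRat ≤ w := by
      have := toRat_roundNE_mono (φ := ψ) hvs.le; rwa [toRat_roundNE_of_exists hvψ] at this
    have hwM : w ≤ v.toRat + G / 2 := by
      have := toRat_roundNE_mono (φ := ψ) hlt.le; rwa [toRat_roundNE_of_exists hMψ] at this
    rcases eq_or_lt_of_le hwM with hwEq | hwLt
    · exfalso; apply hsM
      apply add_eq_midpoint_of_close hjge v a b hgap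
      rw [← hs_def, ← hG_def]
      calc |s - (v.toRat + G / 2)| = |s - w| := by rw [hwEq]
        _ < G / 2 ^ j := hclose
    · rw [toRat_roundNE_eq_of_forall_lt ⟨v, rfl⟩ (forall_lt_of_mem_low hgap hwv hwLt),
        toRat_roundNE_eq_of_forall_lt ⟨v, rfl⟩ (forall_lt_of_mem_low hgap hvs.le hlt)]
  · -- `s > M`: `w ∈ [M, v + G]`
    have hwu : w ≤ v.toRat + G := by
      have := toRat_roundNE_mono (φ := ψ) hsu.le; rwa [toRat_roundNE_of_exists huψ] at this
    have hwM : v.toRat + G / 2 ≤ w := by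
      have := toRat_roundNE_mono (φ := ψ) hgt.le; rwa [toRat_roundNE_of_exists hMψ] at this
    rcases eq_or_lt_of_le hwM with hwEq | hwGt
    · exfalso; apply hsM
      apply add_eq_midpoint_of_close hjge v a b hgap
      rw [← hs_def, ← hG_def]
      calc |s - (v.toRat + G / 2)| = |s - w| := by rw [← hwEq]
        _ < G / 2 ^ j := hclose
    · rw [toRat_roundNE_eq_of_forall_lt ⟨u, rfl⟩ (forall_lt_of_mem_high hu hgap hwGt hwu),
        toRat_roundNE_eq_of_forall_lt ⟨u, rfl⟩ (forall_lt_of_mem_high hu hgap hgt hsu.le)]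

/-- DOUBLE ROUNDING OF SUMS IS INNOCUOUS WHEN `p_ψ ≥ 2 p_φ + 1`, over the embedding hypotheses
only (all signs; saturating round-to-nearest-even in both formats, subnormals included).
[cite: Figueroa1995, §2; Roux2014, Thm 20 and Table II] -/
theorem toRat_roundNE_roundNE_add_of_qexp_le {φ ψ : Format} (hm : 2 * φ.manBits + 2 ≤ ψ.manBits)
    (hq : ψ.qexp ≤ φ.qexp) (hmax : φ.maxRat ≤ ψ.maxRat) (a b : MiniFloat φ) :
    (roundNE φ (roundNE ψ (a.toRat + b.toRat)).toRat).toRat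
      = (roundNE φ (a.toRat + b.toRat)).toRat := by
  rcases lt_trichotomy 0 (a.toRat + b.toRat) with hpos | hzero | hneg
  · exact toRat_roundNE_roundNE_add_of_pos_of_qexp_le hm hq hmax a b hpos
  · exact toRat_roundNE_roundNE_of_exists ⟨MiniFloat.zero ψ, by rw [toRat_zero]; exact hzero⟩
  · have h := toRat_roundNE_roundNE_add_of_pos_of_qexp_le hm hq hmax (flipSign a) (flipSign b)
      (by rw [toRat_flipSign, toRat_flipSign]; linarith)
    rw [toRat_flipSign, toRat_flipSign, show -a.toRat + -b.toRat = -(a.toRat + b.toRat) by ring,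
      toRat_roundNE_neg, toRat_roundNE_neg, toRat_roundNE_neg, neg_inj] at h
    exact h

/-! ## §3 Theorem D-dr for every embedded pair of records -/

/-- CLAUSE (W) FOR EVERY PAIR OF RECORDS: `2·m_φ + 2 ≤ m_ψ`, `qexp ψ ≤ qexp φ`,
`maxRat φ ≤ maxRat ψ` ⇒ `DRAdd φ ψ` — no bias hypothesis (Roux's FLT hypotheses plus the range
clause of saturation). [cite: Figueroa1995, §2; Roux2014, Table II] -/
theorem drAdd_of_wide_of_qexp_le {φ ψ : Format} (hm : 2 * φ.manBits + 2 ≤ ψ.manBits)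
    (hq : ψ.qexp ≤ φ.qexp) (hmax : φ.maxRat ≤ ψ.maxRat) : DRAdd φ ψ :=
  fun a b => toRat_roundNE_roundNE_add_of_qexp_le hm hq hmax a b

/-- CLAUSE (W) read through the embedding test: `embedsTest φ ψ ∧ 2·m_φ + 2 ≤ m_ψ ⇒ DRAdd φ ψ`.
[cite: Figueroa1995, §2; Roux2014, Table II] -/
theorem drAdd_of_wide_of_embedsTest {φ ψ : Format} (hE : embedsTest φ ψ = true)
    (hm : 2 * φ.manBits + 2 ≤ ψ.manBits) : DRAdd φ ψ := by
  have hE' := hE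
  simp only [embedsTest, Bool.and_eq_true, decide_eq_true_eq] at hE'
  obtain ⟨⟨_, hq⟩, hM⟩ := hE'
  exact drAdd_of_wide_of_qexp_le hm hq ((maxRat_le_maxRat_iff hq).2 hM)

/-- THEOREM D-dr FOR EVERY EMBEDDED PAIR OF RECORDS WITH `P_φ ≥ 2`: if `F_φ ⊆ F_ψ` (`embedsTest`)
and `1 ≤ m_φ`, then `DRAdd φ ψ ↔ drAddTest φ ψ` — clause (S) for `P_ψ = P_φ`
(`drAdd_of_manBits_eq`), clause (T) on the strip `P_φ < P_ψ ≤ 2 P_φ` (`drAdd_iff_lt_threshold`),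
clause (W) above it (`drAdd_of_wide_of_qexp_le`). No bias hypothesis. -/
theorem drAdd_iff_test {φ ψ : Format} (hE : embedsTest φ ψ = true) (h1 : 1 ≤ φ.manBits) :
    DRAdd φ ψ ↔ drAddTest φ ψ = true := by
  have hE' := hE
  simp only [embedsTest, Bool.and_eq_true, decide_eq_true_eq] at hE'
  obtain ⟨⟨hmm, hq⟩, hM⟩ := hE'
  have hmax : φ.maxRat ≤ ψ.maxRat := (maxRat_le_maxRat_iff hq).2 hM
  rcases Nat.lt_or_ge φ.manBits ψ.manBits with hlt | hge
  · rcases Nat.lt_or_ge ψ.manBits (2 * φ.manBits + 2) with h2 | h2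
    · exact drAdd_iff_test_of_lt hE h1 hlt (by omega)
    · refine ⟨fun _ => ?_, fun _ => drAdd_of_wide_of_qexp_le h2 hq hmax⟩
      simp only [drAddTest, hE, Bool.true_and, Bool.or_eq_true, beq_iff_eq, decide_eq_true_eq]
      omega
  · have hm : φ.manBits = ψ.manBits := le_antisymm hmm hge
    refine ⟨fun _ => ?_, fun _ => drAdd_of_manBits_eq hm h1 hq hmax⟩
    simp only [drAddTest, hE, Bool.true_and, Bool.or_eq_true, beq_iff_eq, decide_eq_true_eq]
    omega

/-- The same decision with the three clauses spelled out: for an embedded pair with `1 ≤ m_φ`,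
`DRAdd φ ψ ↔ (m_φ = m_ψ ∨ 2·m_φ + 2 ≤ m_ψ ∨ maxScaled φ < drThreshold φ ψ)`. -/
theorem drAdd_iff_clauses {φ ψ : Format} (hE : embedsTest φ ψ = true) (h1 : 1 ≤ φ.manBits) :
    DRAdd φ ψ ↔ (φ.manBits = ψ.manBits ∨ 2 * φ.manBits + 2 ≤ ψ.manBits ∨
      φ.maxScaled < drThreshold φ ψ) := by
  rw [drAdd_iff_test hE h1]
  simp only [drAddTest, hE, Bool.true_and, Bool.or_eq_true, beq_iff_eq, decide_eq_true_eq,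
    or_assoc]

/-- Standard-operand form: for `φ` a standard operand record (`1 ≤ m_φ`, `2^(P_φ) - 1` in range)
embedded in `ψ` (`Embeds φ ψ`, the value-set inclusion itself), `DRAdd φ ψ ↔ drAddTest φ ψ`. -/
theorem drAdd_iff_test_of_embeds {φ ψ : Format} (hstd : stdOperand φ = true) (hEmb : Embeds φ ψ) :
    DRAdd φ ψ ↔ drAddTest φ ψ = true := by
  have hE : embedsTest φ ψ = true := (embeds_iff_test hstd).1 hEmb
  simp only [stdOperand, Bool.and_eq_true, decide_eq_true_eq] at hstd
  exact drAdd_iff_test hE hstd.1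

/-! ## §4 The named payoff: binary8p3 through binary16 without the phantom record -/

/-- binary8p3 and binary8p3f sums through binary16 are innocuous, directly from clause (W) over
the embedding test (`m = 2`, `m' = 10 ≥ 6`; exponent bias `16 > 15` is no longer an obstacle —
compare `Binary8p3_add_via_Binary16` in `DoubleRoundingDecision.lean`, which goes through the
phantom record `Binary16W`). [cite: Figueroa1995, §2] -/
theorem Binary8p3_add_via_Binary16_direct : DRAdd Binary8p3 Binary16 ∧ DRAdd Binary8p3F Binary16 :=
  ⟨drAdd_of_wide_of_embedsTest (by decide +kernel) (by decide),
    drAdd_of_wide_of_embedsTest (by decide +kernel) (by decide)⟩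

/-- SAME QUANTUM, SMALLER BIAS — A PAIR OUTSIDE THE REACH OF THE BIAS-HYPOTHESIS THEOREM: the
narrow record `⟨1, 6, 6, 1⟩` (`P = 2`, quantum `2^-6`, exponent bias `6`, largest value `96`
quanta) and the wide record `⟨4, 3, 9, 15⟩` (`P = 5 = 2·2 + 1`, the SAME quantum `2^-6`, bias
`3 < 6`, largest value `7936` quanta): the embedding test passes, clause (W) applies and `DRAdd`
holds (sums such as `32 + 1`, `48 + 1`, `96 + 3` quanta are NOT values of the wide record, so the
Figueroa mechanism is exercised), while `bias_X ≤ bias_Y` fails — decided by `drAdd_iff_test`.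
(The records are written inline; no new definitions.) -/
theorem drAdd_sameQuantum :
    DRAdd (⟨1, 6, 6, 1, by decide⟩ : Format) ⟨4, 3, 9, 15, by decide⟩ ∧
      drAddTest (⟨1, 6, 6, 1, by decide⟩ : Format) ⟨4, 3, 9, 15, by decide⟩ = true ∧
      ¬ (⟨1, 6, 6, 1, by decide⟩ : Format).bias ≤ (⟨4, 3, 9, 15, by decide⟩ : Format).bias :=
  ⟨(drAdd_iff_test (by decide +kernel) (by decide)).2 (by decide +kernel), by decide +kernel,
    by decide⟩

/-- The exhaustion cross-check of `drAdd_sameQuantum`: all `28²` operand pairs of the narrow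
record, by the matrix file's engine `drAdd_of_all` (second implementation inside the kernel). -/
theorem drAdd_sameQuantum_by_exhaustion :
    DRAdd (⟨1, 6, 6, 1, by decide⟩ : Format) ⟨4, 3, 9, 15, by decide⟩ :=
  drAdd_of_all (by decide +kernel)

end Summit.Ventures.CertifiedArithmetic
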